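import Mathlib
import Literature.Computability.AlgebraicComplexity.NewtonPolygonTau
import HarnessLib

/-!
# KPTT 2015, Proposition 1: convexly independent subsets of Minkowski sums of `m` planar sets can have
# `t^{m/3} - 1` points (the limit of the convexity method)

Topic `Literature/Computability/AlgebraicComplexity`. Source: P. Koiran, N. Portier, S. Tavenas, S. Thomassé,
*A τ-conjecture for Newton polygons*, Found. Comput. Math. 15 (2015) 185–197 (arXiv:1308.2286), §4, Example 3,
Lemma 2 and Proposition 1 (materialised text p0007, L76–125, read this session).

KPTT define `M_m(t)` = the maximal cardinality of a convexly independent subset of a Minkowski sum `P_0 + ⋯ + P_{m-1}`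
of `m` sets of `t` points in the Euclidean plane (the open problem of [BBFKOTT10] they cite), remark that the
Eisenbrand–Pach–Rothvoß–Sopher bound (`KPTT.theorem5/6` in `NewtonPolygonTau`) proves Conjecture 1 only through
`M_m(t)`, and show that `M_m(t) = t^{Ω(m)}`, so that "other ingredients than Theorem 4 will be needed":

* Example 3: `P_k = {(b^{2k} i, b^k j) : 0 ≤ i < b², 0 ≤ j < b}`, whose sum is the grid `[0, b^{2m}) × [0, b^m)`;
* Lemma 2: the grid `M × N` contains `n` convexly independent points whenever `n(n-1)/2 < M` and `n < N`
  (endpoints of segments of horizontal length `i` and slope `1/i`);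
* **Proposition 1: for all `m` and infinitely many `t`, `M_m(t) ≥ t^{m/3} - 1`** (take `t = b³`, `n = b^m - 1`).

Recorded (`KPTT.proposition1`) in the explicit form of its proof: for every `m` and every `b ≥ 2` there are `m`
planar sets of `b³` points each and a convexly independent subset of their Minkowski sum with at least `b^m - 1`
points.  Convex independence is Mathlib's `ConvexIndependent ℝ Subtype.val`, as in `NewtonPolygonTauBounds`.
PROVED in the sibling file `NewtonPolygonKPTTProp1Proofs` (`KPTT.proposition1_holds`), so this is not named-fact
debt.  Honest framing: a calibration of the convexity method (lower bound for a combinatorial quantity); it says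
nothing about the τ-conjecture itself or about `VP ≠ VNP` (NOT proved). [cite: KoiranPortierTavenasThomasse2015,
Proposition 1]
-/

noncomputable section

namespace Literature.Computability.AlgebraicComplexity.KPTT

open scoped Pointwise

/-- **KPTT 2015, Proposition 1** (printed: "For all `m` and infinitely many values of `t` we have:
`M_m(t) ≥ t^{m/3} - 1`", where `M_m(t)` is "the maximal cardinality of a convexly independent subset of the Minkowski
sum of `m` sets `P_0, …, P_{m-1}` of `t` points in the Euclidean plane"; proof: Example 3 with `t = b³` and Lemma 2
with `M = b^{2m}`, `N = b^m`, `n = b^m - 1`).  Typed in the form the proof gives: for every `m` and every `b ≥ 2`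
(`t = b³`) there are sets `P_0, …, P_{m-1} ⊂ ℝ²` with `#P_k = b³` and a convexly independent `S ⊆ Σ_k P_k` with
`#S ≥ b^m - 1`. [cite: KoiranPortierTavenasThomasse2015, Proposition 1 (with Example 3, Lemma 2), §4 p. 7] -/
def proposition1 : Prop :=
  ∀ (m b : ℕ), 2 ≤ b → ∃ P : Fin m → Finset (Fin 2 → ℝ), (∀ k, (P k).card = b ^ 3) ∧
    ∃ S : Finset (Fin 2 → ℝ), (↑S : Set (Fin 2 → ℝ)) ⊆ ↑(∑ k, P k) ∧
      ConvexIndependent ℝ (Subtype.val : ↥(S : Set (Fin 2 → ℝ)) → (Fin 2 → ℝ)) ∧ b ^ m - 1 ≤ S.card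

end Literature.Computability.AlgebraicComplexity.KPTT

end
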